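import Mathlib
import HarnessLib
import Summits.HubbardSuperconductivity.HubbardSuperconductivity.Theorems.KLProgrammeH10TwoPointLimitPerturbedCountShift
import Summits.HubbardSuperconductivity.HubbardSuperconductivity.Theorems.KLProgrammeH10TwoPointLimitPerturbedCountDepth
import Summits.HubbardSuperconductivity.HubbardSuperconductivity.Theorems.KLProgrammePerturbedCountConstantsDefs

/-!
# Route `KLProgramme` — crux K1 `H10TwoPointLimit` (stmt-HubbardSuperconductivity-19938):
# the grid counts on the perturbed curve in the NAMED constants of `KLProgrammePerturbedCountConstantsDefs.lean`

The landed grid counts `…PerturbedCountShift/Anti/Depth.lean` carry their constants expanded in the `BandBounds` fields and `κ₀, κ₁, κ₂`.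
This file restates the four counts consumed by the two-dimensional assembly — the transversal fibres, the three shift ranges, the Cooper
range total and the anti-diagonal total — with the constants NAMED (`pcSE, pcAE, pcMG, pcManti, pcMdiag, pcAdiag` and the losses
`pcE4, pcOdd, pcEven, pcDiag`); each is the landed statement by definitional unfolding (`rfl` of the `pc*` abbreviations), plus the
positivity of the named constants for `0 ≤ κ₁ < Dt_min`, `0 ≤ κ₂`. Everything is PROVED; no definitions.
References: BGM 2006 Lemma 3.1 / App. A2 [cite: BenfattoGiulianiMastropietro2006].
-/

noncomputable section

namespace Summit.HubbardSuperconductivity.HubbardSuperconductivity.Theorems.PerturbedFermiCurve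

set_option linter.dupNamespace false -- summit = problem name (single-conjunct summit), D-0017

open Real Set
open Literature.MathematicalPhysics.QuantumLattice Literature.MathematicalPhysics.QuantumLattice.BandSectorCounting

/-- **Positivity of the named constants** for `0 ≤ κ₁ < Dt_min`, `0 ≤ κ₂`. [folklore] -/
theorem pc_pos {a b : ℝ} (B : BandBounds a b) {κ₁ κ₂ : ℝ} (hκ₁0 : 0 ≤ κ₁) (hκ₁ : κ₁ < B.Dtmin) (hκ₂0 : 0 ≤ κ₂) :
    0 ≤ pcCV B κ₁ ∧ 0 < pcSE B κ₁ ∧ 0 < pcU1 B κ₁ ∧ 0 < pcU2 B κ₁ κ₂ ∧ 0 < pcAE B κ₁ κ₂ ∧ 0 < pcMG B κ₁ κ₂ ∧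
      0 < pcManti B κ₁ κ₂ ∧ 0 < pcMdiag B κ₁ ∧ 0 < pcAdiag B κ₁ κ₂ := by
  have hs := B.smax_pos; have hDt := B.Dtmin_pos
  have hden : 0 < B.Dtmin - κ₁ := sub_pos.2 hκ₁
  have hCV : 0 ≤ pcCV B κ₁ := by unfold pcCV; positivity
  have hSE : 0 < pcSE B κ₁ := by unfold pcSE; linarith
  have hU1 : 0 < pcU1 B κ₁ := by unfold pcU1; positivity
  have hU2 : 0 < pcU2 B κ₁ κ₂ := by unfold pcU2; positivity
  have hAE : 0 < pcAE B κ₁ κ₂ := by unfold pcAE; positivity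
  have hMG : 0 < pcMG B κ₁ κ₂ := by unfold pcMG; positivity
  have hMa : 0 < pcManti B κ₁ κ₂ := by unfold pcManti; positivity
  have hMd : 0 < pcMdiag B κ₁ := by unfold pcMdiag; positivity
  have hAd : 0 < pcAdiag B κ₁ κ₂ := by unfold pcAdiag; positivity
  exact ⟨hCV, hSE, hU1, hU2, hAE, hMG, hMa, hMd, hAd⟩

section Bridge

variable {a b : ℝ} (B : BandBounds a b) {δ : (Fin 2 → ℝ) → ℝ} (hδs : ContDiff ℝ 2 δ) (heven : ∀ k, δ (-k) = δ k)
  {κ₀ κ₁ κ₂ μ : ℝ} (hδ : ∀ k : Fin 2 → ℝ, |δ k| ≤ κ₀) (hlo : a ≤ μ - κ₀) (hhi : μ + κ₀ ≤ b)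
  (hκ : ∀ k : Fin 2 → ℝ, ‖fderiv ℝ δ k‖ ≤ κ₁) (hκ₁ : κ₁ < B.Dtmin) (hκ₂ : ∀ k : Fin 2 → ℝ, ‖fderiv ℝ (fderiv ℝ δ) k‖ ≤ κ₂)
  {u : ℝ → ℝ} (hu : ∀ θ, IsBandFermiRadius (μ - δ (u θ • dir θ)) θ (u θ))
include B hδs hδ hlo hhi hκ hκ₁ hκ₂ hu

/-- `count_transversalE` in the named constants. [cite: BenfattoGiulianiMastropietro2006, Lemma 3.1] -/
theorem count_transversal_pc {P : ℝ × ℝ} {w δ' lam : ℝ} (hw : 0 < w) (hlam : 0 < lam) (hδ' : 0 ≤ δ') {N : ℕ}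
    (hN : (N : ℝ) * w = 2 * π) (hMΓ : 0 < pcMG B κ₁ κ₂) :
    ∑ i ∈ Finset.range N, ((((Finset.range N).filter fun c : ℕ =>
        |hfunE δ u μ P (w / 2 + i * w) (w / 2 + c * w)| ≤ δ' ∧ lam ≤ |h3E δ u P (w / 2 + i * w) (w / 2 + c * w)|).card : ℝ)) ≤
      N * ((2 * π / (lam / (2 * pcMG B κ₁ κ₂)) + 1) * (2 * ((4 * δ' / lam) / w + 1))) :=
  count_transversalE B hδs hδ hlo hhi hκ hκ₁ hκ₂ hu hw hlam hδ' hN hMΓ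

/-- `count_transversalE'` in the named constants. [cite: BenfattoGiulianiMastropietro2006, Lemma 3.1] -/
theorem count_transversal'_pc {P : ℝ × ℝ} {w δ' lam : ℝ} (hw : 0 < w) (hlam : 0 < lam) (hδ' : 0 ≤ δ') {N : ℕ}
    (hN : (N : ℝ) * w = 2 * π) (hMΓ : 0 < pcMG B κ₁ κ₂) :
    ∑ c ∈ Finset.range N, ((((Finset.range N).filter fun i : ℕ =>
        |hfunE δ u μ P (w / 2 + i * w) (w / 2 + c * w)| ≤ δ' ∧ lam ≤ |h3E δ u P (w / 2 + c * w) (w / 2 + i * w)|).card : ℝ)) ≤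
      N * ((2 * π / (lam / (2 * pcMG B κ₁ κ₂)) + 1) * (2 * ((4 * δ' / lam) / w + 1))) :=
  count_transversalE' B hδs hδ hlo hhi hκ hκ₁ hκ₂ hu hw hlam hδ' hN hMΓ

omit hκ₂ in
/-- `krangeE` in the named constants. [cite: BenfattoGiulianiMastropietro2006, App. A2] -/
theorem krange_pc {P : ℝ × ℝ} {w δ' lam τ η₀ : ℝ} (hw : 0 < w) {N k : ℕ} (hN : (N : ℝ) * w = 2 * π) (hk : k < N)
    (hτ : τ < π) (hlo' : a ≤ μ - κ₀ - η₀) (hhi' : μ + κ₀ + η₀ ≤ b) (hδη : δ' ≤ η₀)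
    (hsmall : 2 * (B.Cg * pcE4 B κ₀ κ₁ lam η₀) ≤ τ) {x : ℝ}
    (hQ : |hfunE δ u μ P x (x + k * w)| ≤ δ' ∧ |h3E δ u P x (x + k * w)| < lam ∧ |h3E δ u P (x + k * w) x| < lam) :
    (k : ℝ) * w ≤ τ ∨ |(k : ℝ) * w - π| ≤ τ ∨ 2 * π - τ ≤ (k : ℝ) * w :=
  krangeE B hδs hδ hlo hhi hκ hκ₁ hu hw hN hk hτ hlo' hhi' hδη hsmall hQ

include heven in
/-- `count_odd_total_perturbed` in the named constants. [cite: BenfattoGiulianiMastropietro2006, (2.80)] -/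
theorem count_odd_total_pc {P : ℝ × ℝ} {w δ' lam τ η₀ : ℝ} (hw : 0 < w) {N Nh : ℕ} (hN : (N : ℝ) * w = 2 * π)
    (hNh : (Nh : ℝ) * w = π) (hNN : N = 2 * Nh) (hδ'0 : 0 < δ') (hη₀ : 0 < η₀) (hlam : 0 < lam) (hτ : 0 < τ)
    (hδη : δ' ≤ η₀ / 2) (hlo' : a ≤ μ - κ₀ - η₀) (hhi' : μ + κ₀ + η₀ ≤ b)
    (hsmall : pcOdd B κ₀ κ₁ κ₂ (2 * lam) η₀ τ ≤ B.hmin / 2)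
    (hκA : κ₁ * pcAE B κ₁ κ₂ ≤ B.hmin / 2) (hAE : 0 < pcAE B κ₁ κ₂) (hMΓ : 0 < pcMG B κ₁ κ₂) :
    ∑ k ∈ (Finset.range N).filter (fun k : ℕ => |(k : ℝ) * w - π| ≤ τ), ((((Finset.range N).filter fun i : ℕ =>
        |hfunE δ u μ P (w / 2 + i * w) (w / 2 + i * w + k * w)| ≤ δ' ∧
        |h3E δ u P (w / 2 + i * w) (w / 2 + i * w + k * w)| < lam ∧
        |h3E δ u P (w / 2 + i * w + k * w) (w / 2 + i * w)| < lam).card : ℝ)) ≤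
      N + 2 * (2 * π / min (η₀ / (2 * ((4 + κ₁) * pcAE B κ₁ κ₂ * τ))) (lam / pcMG B κ₁ κ₂) + 1) *
        ((2 * δ' / (B.hmin / 2 * w)) * (2 * (1 + Real.log N)) / w + N) :=
  count_odd_total_perturbed B hδs heven hδ hlo hhi hκ hκ₁ hκ₂ hu hw hN hNh hNN hδ'0 hη₀ hlam hτ hδη hlo' hhi' hsmall hκA hAE hMΓ

/-- `count_anti_totalE` in the named constants. [cite: BenfattoGiulianiMastropietro2006, Lemma 3.1 / (2.80)] -/
theorem count_anti_total_pc {P : ℝ × ℝ} {w Cδ lam τ η₀ η₁ : ℝ} (hw : 0 < w) (hw1 : w ≤ 1) {N J : ℕ} (hN : (N : ℝ) * w = 2 * π)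
    (hJ : (2 : ℝ) ^ J * w = π) (hCδ : 0 < Cδ) (hlam : 0 < lam) (hτ : 0 < τ) (hη₀ : 0 < η₀) (hη₁ : 0 < η₁)
    (h2δ : Cδ * w ≤ η₀ / 2) (hlo' : a ≤ μ - κ₀ - η₀) (hhi' : μ + κ₀ + η₀ ≤ b)
    (heven' : pcEven B κ₀ κ₁ κ₂ lam η₀ τ ≤ B.hmin / 2) (hH : pcDiag B κ₀ κ₁ κ₂ η₀ η₁ ≤ 2 * B.hmin)
    (hMa : 0 < pcManti B κ₁ κ₂) (hMG : 0 < pcMG B κ₁ κ₂) (hM : 0 < pcMdiag B κ₁) (hA : 0 < pcAdiag B κ₁ κ₂) :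
    ∑ s ∈ Finset.range (4 * N), ((((Finset.range ⌊τ / w⌋₊).filter fun i : ℕ =>
        |hfunE δ u μ P (w / 2 + s * (w / 2) - (w + i * w) / 2) (w / 2 + s * (w / 2) + (w + i * w) / 2)| ≤ Cδ * w ∧
        |h3E δ u P (w / 2 + s * (w / 2) + (w + i * w) / 2) (w / 2 + s * (w / 2) - (w + i * w) / 2) +
          h3E δ u P (w / 2 + s * (w / 2) - (w + i * w) / 2) (w / 2 + s * (w / 2) + (w + i * w) / 2)| ≤ 2 * lam).card : ℝ)) ≤
      (τ / min (η₀ / (2 * pcManti B κ₁ κ₂ * τ)) (2 * lam / pcMG B κ₁ κ₂) + 1) * (2 *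
        (((J : ℝ) + 1) * (2 * Real.sqrt (Cδ / (B.hmin / 2)) *
            (2 * (32 * (4 * π / min (η₀ / (2 * pcMdiag B κ₁)) (η₁ / (4 * pcAdiag B κ₁ κ₂)) + 1) / η₁ + 16 * π / η₀) * Cδ +
              (8 * (4 * π / min (η₀ / (2 * pcMdiag B κ₁)) (η₁ / (4 * pcAdiag B κ₁ κ₂)) + 1) / Real.sqrt (2 * B.hmin)) * Real.sqrt (2 * Cδ) +
              2 * (4 * π / min (η₀ / (2 * pcMdiag B κ₁)) (η₁ / (4 * pcAdiag B κ₁ κ₂)) + 1)) +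
          (2 * (32 * (4 * π / min (η₀ / (2 * pcMdiag B κ₁)) (η₁ / (4 * pcAdiag B κ₁ κ₂)) + 1) / η₁ + 16 * π / η₀) *
              (2 * Cδ * Real.sqrt (2 * pcManti B κ₁ κ₂) / (B.hmin / 2)) * Real.sqrt (Cδ * π) +
            Real.sqrt 2 * (8 * (4 * π / min (η₀ / (2 * pcMdiag B κ₁)) (η₁ / (4 * pcAdiag B κ₁ κ₂)) + 1) / Real.sqrt (2 * B.hmin)) *
              (2 * Cδ * Real.sqrt (2 * pcManti B κ₁ κ₂) / (B.hmin / 2)) +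
            2 * (4 * π / min (η₀ / (2 * pcMdiag B κ₁)) (η₁ / (4 * pcAdiag B κ₁ κ₂)) + 1) *
              (2 * Cδ * Real.sqrt (2 * pcManti B κ₁ κ₂) / (B.hmin / 2)) / Real.sqrt Cδ) +
          8 * π * (2 * Cδ * Real.sqrt (2 * pcManti B κ₁ κ₂) / (B.hmin / 2)) / Real.sqrt (2 * Cδ * π)) / w + 4 * N)) :=
  count_anti_totalE B hδs hδ hlo hhi hκ hκ₁ hκ₂ hu hw hw1 hN hJ hCδ hlam hτ hη₀ hη₁ h2δ hlo' hhi' heven' hH hMa hMG hM hA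

end Bridge

end Summit.HubbardSuperconductivity.HubbardSuperconductivity.Theorems.PerturbedFermiCurve

end
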